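import Literature.AlgebraicGeometry.HodgeTheory.AbelianVarietyCyclotomicAutomorphismWeilType
import Literature.AlgebraicGeometry.HodgeTheory.WeilClassesFieldSubfieldAlgebraic
import HarnessLib

/-!
# The square `δ²` of a cyclotomic automorphism of level `2k`, `k` even: the index-two subfield
# `ℚ(δ²) = ℚ(ζ_k) ⊂ ℚ(δ) = ℚ(ζ_{2k})`, `Φ_{2k}(X) = Φ_k(X²)` — its analytic type `n_{ζ²}(δ²) = n_ζ(δ) + n_{-ζ}(δ)`,
# Moonen–Zarhin's Remark (1) «`W_{F′}` Hodge ⟹ `W_F` Hodge», `W_F ⊆ ⟨W_{F′} ∧ W_{F′}⟩`, and the descent of algebraicity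

Family `hodge`, lane `lit-hodgefound` (seat p03, GEN 36 «Hodge classes from the analytic type of a cyclotomic
automorphism»), topic `Literature/AlgebraicGeometry/HodgeTheory`.  Theorems only: no definition, no instance, no named
fact (net Literature debt 0).  For an endomorphism `δ` of a complex abelian variety `A` with `Φ_{2k}(δ) = 0` and `k`
EVEN (`4 ∣ 2k`), the cyclotomic field `F′ = ℚ(δ) ≅ ℚ(ζ_{2k})` has the INDEX-TWO subfield `F = ℚ(δ²) ≅ ℚ(ζ_k)`
(`φ(2k) = 2φ(k)`; Mathlib: `Φ_{2k} = Φ_k(X²)`, `cyclotomic_expand_eq_cyclotomic`), generated by the square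
`δ² = δ ≫ δ`, which satisfies `Φ_k(δ²) = 0`.  This is EXACTLY the shape `P = R(T²)`, `ψ = φ²` of the tree's
`WeilClassesFieldSubfieldAlgebraic` §4 (there for Deligne's `E ⊃ E₀`), so Moonen–Zarhin's Remark (1) for the pair
`F ⊂ F′` applies on the carriers `weilClassesField A δ Φ_{2k} r` ⊂ `Hʳ`, `weilClassesField A (δ ≫ δ) Φ_k (2r) ⊂ H^{2r}`
(`φ(2k)·r = 2g`), and the analytic type of `δ²` is read off that of `δ` by GEN 35's `n_η(φ^e) = Σ_{ζ^e = η} n_ζ(φ)`.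

## Sources, verbatim (held texts)

B. Moonen, Yu. Zarhin, *Weil classes on abelian varieties*, J. reine angew. Math. 496 (1998) = alg-geom/9612017, held
`paper:arxiv-alg-geom_9612017`, chunk p0004 L44–L52: «(1) Suppose we have two subfields `F ⊆ F′ ⊆ End⁰(X)`. […] it
follows directly from Criterion (crit1) that `W_{F′}` consists of Hodge classes ⟹ `W_F` consists of Hodge classes»;
L64–L76: «Furthermore, if `F ⊆ F′` then we have the implication `W_{F′}` consists of decomposable Hodge classes ⟹ `W_F`
consists of decomposable Hodge classes. This is a direct consequence of Criterion (crit2). It can also be seen more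
directly, by using that `W_F` is contained in the vector subspace generated by exterior products of elements of
`W_{F′}`»; chunk p0001 L78–L81 «we have `n_σ + n_{σ′} = 2g/[F:ℚ]` for all `σ ∈ Σ_F`».

Yu. G. Zarhin, *Jacobians with automorphisms of prime order*, MRR 2021 = arXiv:2109.06794, held `paper:arxiv-2109.06794`,
§1 chunk p0003 L38–L47 (the multiplicities `a_j` of the embeddings `ζ_p ↦ ζ_p^j` on `Ω¹(X)`).

C. Voisin, *Hodge Theory and Complex Algebraic Geometry II* (2003), Prop. 9.20 («`cl(Z · Z′) = cl(Z) ∪ cl(Z′)`»; the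
tree's `AbelianVariety.cupProduct_mem_algebraicClasses'`).

## What is proved (namespace `Literature.AlgebraicGeometry.HodgeTheory.AbelianVariety`)

Hypotheses: `hk : 2 ∣ k` (and `0 < k` / `1 < k` where needed), `hδ : Φ_{2k}(δ) = 0`
(`(cyclotomic (2 * k) ℤ).eval₂ (Int.castRingHom (End A)) (End.of δ) = 0`).

* §0 `cyclotomic_two_mul_eq_comp_X_sq` (`Φ_{2k} = Φ_k(X²)`), private helpers (`φ(2k) = 2φ(k)`, `Φ_k(0) ≠ 0`,
  `ζ ↦ ζ²` maps the primitive `2k`-th roots onto the primitive `k`-th roots, two-to-one with fibres `{ζ, -ζ}`), and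
  `exists_isPrimitiveRoot_sq_eq` (every primitive `k`-th root is such a square).
* §1 THE SQUARE: **`eval₂_cyclotomic_comp_self_eq_zero`** (`Φ_k(δ ≫ δ) = 0`), **`eigenMultiplicity_comp_self_sq_eq`**
  (`n_{ζ²}(δ²) = n_ζ(δ) + n_{-ζ}(δ)` for every `2k`-th root of unity `ζ`: the multiplicity of an embedding of `F` is the
  sum over the two embeddings of `F′` above it), **`forall_eigenMultiplicity_comp_self_eq_inv_of_symmetric`** (a
  SYMMETRIC type of `δ` (`n_ζ = n_{ζ⁻¹}`, g36-#1) descends to a symmetric type of `δ²`) — whence, by g36-#1,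
  **`forall_isOfHodgeType_weilClassesField_comp_self_of_symmetric`**: «`W_{F′}` consists of Hodge classes ⟹ `W_F`
  consists of Hodge classes» for `F = ℚ(δ²) ⊂ F′ = ℚ(δ)`, and `forall_isOfHodgeType_weilClassesField_comp_self_of_forall`
  (the same with the Hodge property of `W_{F′} ⊗ ℂ` as hypothesis).
* §2 THE WEIL CLASSES: **`weilClassesField_comp_self_le_span_cupProduct`** («`W_F` is contained in the vector subspace
  generated by exterior products of elements of `W_{F′}`»: `W_{ℚ(δ²)} ⊗ ℂ ⊆ span_ℂ {a ⌣ b | a, b ∈ W_{ℚ(δ)} ⊗ ℂ}`),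
  **`weilClassesField_comp_self_le_algebraicClasses`** (`W_{ℚ(δ)} ⊗ ℂ` algebraic ⟹ `W_{ℚ(δ²)} ⊗ ℂ` algebraic),
  `weilClassesField_comp_self_le_algebraicClasses_of_isRationalClass` (ONE non-zero rational algebraic class of
  `W_{ℚ(δ)} ⊗ ℂ` suffices).
* §3 LEVEL `8` AND LEVEL `12`: `Φ_8(δ) = 0 ⟹ Φ_4(δ²) = 0`, `Φ_12(δ) = 0 ⟹ Φ_6(δ²) = 0`, and with g36-#2:
  **`isWeilType_comp_self_of_symmetric_of_cyclotomic_eight`** (a symmetric type at level `8`, `dim A = 2n > 0` ⟹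
  `(A, δ²)` is of Weil type `(n, 1)` for `ℚ(δ²) = ℚ(i)`), `isWeilType_comp_self_iff_of_cyclotomic_eight`
  (`IsWeilType A (δ ≫ δ) n 1 ⟺ 0 < n ∧ dim A = 2n ∧ n_i(δ²) = n_{-i}(δ²)`),
  **`isWeilType_of_symmetric_of_cyclotomic_twelve`** (level `12`, `ℚ(δ²) = ℚ(ζ_6) = ℚ(√-3)`: Weil type `(n, 3)` of
  `(A, 2δ² - 1)`).

## References

* [MoonenZarhin1998WeilClasses] B. J. J. Moonen, Yu. G. Zarhin, *Weil classes on abelian varieties*, J. reine angew.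
  Math. 496 (1998) 83–92 = arXiv:alg-geom/9612017, «In practice…» Remark (1) (chunk p0004 L44–L76), §1 (chunk p0001).
* [Zarhin2021PrimeOrderJacobians] Yu. G. Zarhin, *Jacobians with automorphisms of prime order*, Math. Research Reports
  (2021), arXiv:2109.06794, §1 (chunk p0003).
* [VoisinHodgeII2003] C. Voisin, *Hodge Theory and Complex Algebraic Geometry II* (2003), Prop. 9.20.
* [vanGeemen1994HodgeAV] B. van Geemen, LNM 1594 (1994), 4.9–4.10.
* [Deligne1982HodgeCycles] P. Deligne (notes by J. S. Milne), LNM 900 (1982), §5, proof of Prop. 5.1 (`E = F[√α]`).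
-/

noncomputable section

open CategoryTheory CategoryTheory.Limits Module Polynomial

namespace Literature.AlgebraicGeometry.HodgeTheory

namespace AbelianVariety

open Literature.AlgebraicTopology.SingularHomology
open Literature.AlgebraicGeometry.Motives (AlgPoints IsSmoothProjective)

/-! ## §0 `Φ_{2k} = Φ_k(X²)` for `k` even; squares of primitive `2k`-th roots -/

section Cyclotomic

variable {k : ℕ}

/-- **`Φ_{2k}(X) = Φ_k(X²)` for `2 ∣ k`** (`[ℚ(ζ_{2k}) : ℚ(ζ_k)] = 2`, `ζ_{2k}² = ζ_k`). [cite: MoonenZarhin1998WeilClasses, Remark (1) (chunk p0004 L44–L52)] -/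
theorem cyclotomic_two_mul_eq_comp_X_sq (hk : 2 ∣ k) : cyclotomic (2 * k) ℤ = (cyclotomic k ℤ).comp (X ^ 2) := by
  rw [mul_comm, ← cyclotomic_expand_eq_cyclotomic Nat.prime_two hk ℤ, expand_eq_comp_X_pow]

/-- `φ(2k) = 2 φ(k)` for `2 ∣ k`. [folklore] -/
private theorem totient_two_mul_eq (hk : 2 ∣ k) : Nat.totient (2 * k) = 2 * Nat.totient k :=
  Nat.totient_mul_of_prime_of_dvd Nat.prime_two hk

/-- `Φ_k(0) = 1 ≠ 0` for `k > 1`. [folklore] -/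
private theorem eval₂_zero_cyclotomic_ne_zero (hk : 1 < k) : (cyclotomic k ℤ).eval₂ (Int.castRingHom ℂ) 0 ≠ 0 := by
  rw [eval₂_at_zero, cyclotomic_coeff_zero ℤ hk, map_one]
  exact one_ne_zero

/-- The square of a primitive `2k`-th root of unity is a primitive `k`-th root. [folklore] -/
private theorem isPrimitiveRoot_sq (hk0 : 0 < k) {ζ : ℂ} (hζ : IsPrimitiveRoot ζ (2 * k)) : IsPrimitiveRoot (ζ ^ 2) k :=
  hζ.pow (by omega) rfl

/-- For `k` even, `ζ^k = -1` and `-ζ = ζ^{k+1}` is again a primitive `2k`-th root. [folklore] -/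
private theorem isPrimitiveRoot_neg_of_even (hk : 2 ∣ k) (hk0 : 0 < k) {ζ : ℂ} (hζ : IsPrimitiveRoot ζ (2 * k)) :
    IsPrimitiveRoot (-ζ) (2 * k) := by
  have hk1 : ζ ^ k = -1 := (hζ.pow (by omega) (mul_comm 2 k)).eq_neg_one_of_two_right
  have hneg : -ζ = ζ ^ (k + 1) := by rw [pow_succ, hk1, neg_one_mul]
  rw [hneg]
  refine hζ.pow_of_coprime (k + 1) (Nat.Coprime.mul_right ?_ ?_)
  · exact ((Nat.Prime.coprime_iff_not_dvd Nat.prime_two).2 (by omega)).symm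
  · rw [add_comm]
    exact Nat.coprime_add_self_left.2 (Nat.coprime_one_left k)

/-- **Every primitive `k`-th root `η` (`k` even) is the square of a primitive `2k`-th root**: above each embedding of
`F = ℚ(ζ_k)` lie two embeddings `ζ, -ζ` of `F′ = ℚ(ζ_{2k})`. [cite: MoonenZarhin1998WeilClasses, Remark (1) (chunk p0004 L44–L52)] -/
theorem exists_isPrimitiveRoot_sq_eq (hk : 2 ∣ k) (hk0 : 0 < k) {η : ℂ} (hη : IsPrimitiveRoot η k) :
    ∃ ζ : ℂ, IsPrimitiveRoot ζ (2 * k) ∧ ζ ^ 2 = η := by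
  have hζ₀ := Complex.isPrimitiveRoot_exp (2 * k) (by omega)
  set ζ₀ := Complex.exp (2 * Real.pi * Complex.I / (2 * k : ℕ)) with hζ₀def
  haveI : NeZero (2 * k) := ⟨by omega⟩
  have hη2k : η ^ (2 * k) = 1 := by rw [mul_comm, pow_mul, hη.pow_eq_one, one_pow]
  obtain ⟨j, hj, hjη⟩ := hζ₀.eq_pow_of_pow_eq_one hη2k
  -- `j` is even: `(ζ₀^j)^k = η^k = 1` forces `2k ∣ jk`
  have hjk : 2 * k ∣ j * k := by
    rw [← hζ₀.pow_eq_one_iff_dvd, pow_mul, hjη, hη.pow_eq_one]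
  obtain ⟨i, rfl⟩ : 2 ∣ j := Nat.dvd_of_mul_dvd_mul_right hk0 hjk
  refine ⟨ζ₀ ^ i, hζ₀.pow_of_coprime i ?_, by rw [← pow_mul, mul_comm i 2, hjη]⟩
  -- `i` is coprime to `k` (`η = (ζ₀²)^i` is primitive) and odd (`k` even)
  have hω : IsPrimitiveRoot (ζ₀ ^ 2) k := isPrimitiveRoot_sq hk0 hζ₀
  have hηi : η = (ζ₀ ^ 2) ^ i := by rw [← pow_mul, hjη]
  have hik : i.Coprime k := (hω.pow_iff_coprime hk0 i).1 (hηi ▸ hη)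
  have hi2 : ¬ 2 ∣ i := by
    intro h2
    have h := Nat.dvd_gcd h2 hk
    rw [Nat.Coprime.gcd_eq_one hik] at h
    omega
  exact Nat.Coprime.mul_right ((Nat.Prime.coprime_iff_not_dvd Nat.prime_two).2 hi2).symm hik

end Cyclotomic

/-! ## §1 The square `δ² = δ ≫ δ`: `Φ_k(δ²) = 0`, `n_{ζ²}(δ²) = n_ζ(δ) + n_{-ζ}(δ)`, symmetric type descends -/

section Square

variable {A : Motives.AbelianVariety ℂ} {δ : A ⟶ A} {k : ℕ}

/-- **`Φ_{2k}(δ) = 0`, `2 ∣ k` ⟹ `Φ_k(δ ≫ δ) = 0`**: the square generates the index-two subfield `ℚ(δ²) ≅ ℚ(ζ_k)`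
(`Φ_{2k}(δ) = Φ_k(δ²)`). [cite: MoonenZarhin1998WeilClasses, Remark (1) (chunk p0004 L44–L52)] -/
theorem eval₂_cyclotomic_comp_self_eq_zero (hk : 2 ∣ k)
    (hδ : (cyclotomic (2 * k) ℤ).eval₂ (Int.castRingHom (End A)) (End.of δ) = 0) :
    (cyclotomic k ℤ).eval₂ (Int.castRingHom (End A)) (End.of (δ ≫ δ)) = 0 := by
  have heq : algebraMap ℤ (End A) = Int.castRingHom _ := RingHom.ext_int _ _
  have h1 : aeval (End.of δ) (cyclotomic (2 * k) ℤ) = 0 := by rw [aeval_def, heq]; exact hδ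
  have h2 : aeval (End.of δ ^ 2) (cyclotomic k ℤ) = 0 := by
    rw [← expand_aeval, cyclotomic_expand_eq_cyclotomic Nat.prime_two hk, mul_comm k 2]
    exact h1
  have hsq : End.of δ ^ 2 = End.of (δ ≫ δ) := by rw [sq, End.mul_def]
  rw [aeval_def, heq, hsq] at h2
  exact h2

/-- **The analytic type of the square: `n_{ζ²}(δ ≫ δ) = n_ζ(δ) + n_{-ζ}(δ)`** for every `2k`-th root of unity `ζ`
(`k > 0`): the eigenvalue `η = ζ²` of `ρ_a(δ²) = ρ_a(δ)²` collects the two eigenvalues `± ζ` of `ρ_a(δ)` above it — the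
multiplicity of an embedding `σ` of `F = ℚ(δ²)` is the sum of the multiplicities of the two embeddings of `F′ = ℚ(δ)`
restricting to `σ`. [cite: MoonenZarhin1998WeilClasses, §1 (the multiplicities n_σ; chunk p0001 L78–L81) and Remark (1) (chunk p0004)]
[cite: Zarhin2021PrimeOrderJacobians, §1 (chunk p0003 L38–L47)] -/
theorem eigenMultiplicity_comp_self_sq_eq (hk0 : 0 < k)
    (hδ : (cyclotomic (2 * k) ℤ).eval₂ (Int.castRingHom (End A)) (End.of δ) = 0) {ζ : ℂ} (hζ : ζ ^ (2 * k) = 1) :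
    eigenMultiplicity A (δ ≫ δ) (ζ ^ 2) = eigenMultiplicity A δ ζ + eigenMultiplicity A δ (-ζ) := by
  classical
  have h2k : 0 < 2 * k := by omega
  have hpow : End.of δ ^ (2 * k) = 1 := pow_eq_one_of_cyclotomic hδ
  have hη : (ζ ^ 2) ^ (2 * k) = 1 := by rw [← pow_mul, mul_comm, pow_mul, hζ, one_pow]
  have hζ0 : ζ ≠ 0 := fun h0 ↦ by
    rw [h0, zero_pow h2k.ne'] at hζ
    exact zero_ne_one hζ
  have hne : ζ ≠ -ζ := fun h ↦ by
    have h2 : (2 : ℂ) * ζ = 0 := by rw [two_mul]; nth_rw 2 [h]; exact add_neg_cancel ζ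
    exact hζ0 ((mul_eq_zero.1 h2).resolve_left two_ne_zero)
  have hset : ((nthRoots (2 * k) (1 : ℂ)).toFinset.filter fun ζ' ↦ ζ' ^ 2 = ζ ^ 2) = {ζ, -ζ} := by
    ext ζ'
    rw [Finset.mem_filter, Multiset.mem_toFinset, Polynomial.mem_nthRoots h2k, Finset.mem_insert,
      Finset.mem_singleton, sq_eq_sq_iff_eq_or_eq_neg]
    constructor
    · exact fun h ↦ h.2
    · rintro (rfl | rfl)
      · exact ⟨hζ, Or.inl rfl⟩
      · exact ⟨by rw [(even_two_mul k).neg_pow, hζ], Or.inr rfl⟩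
  have hδ2 : End.asHom (End.of δ ^ 2) = δ ≫ δ := by rw [sq, End.mul_def]
  rw [← hδ2, eigenMultiplicity_pow_eq_sum_filter h2k hpow 2 hη, hset, Finset.sum_pair hne]

/-- **A symmetric type descends to the square** (`k` even, `k > 0`): if `n_ζ(δ) = n_{ζ⁻¹}(δ)` for every primitive
`2k`-th root `ζ`, then `n_η(δ ≫ δ) = n_{η⁻¹}(δ ≫ δ)` for every primitive `k`-th root `η` — the carrier form of «it
follows directly from Criterion (crit1) that `W_{F′}` consists of Hodge classes ⟹ `W_F` consists of Hodge classes».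
[cite: MoonenZarhin1998WeilClasses, Remark (1) (chunk p0004 L44–L52)] -/
theorem forall_eigenMultiplicity_comp_self_eq_inv_of_symmetric (hk : 2 ∣ k) (hk0 : 0 < k)
    (hδ : (cyclotomic (2 * k) ℤ).eval₂ (Int.castRingHom (End A)) (End.of δ) = 0)
    (hsym : ∀ ζ : ℂ, IsPrimitiveRoot ζ (2 * k) → eigenMultiplicity A δ ζ = eigenMultiplicity A δ ζ⁻¹) :
    ∀ η : ℂ, IsPrimitiveRoot η k → eigenMultiplicity A (δ ≫ δ) η = eigenMultiplicity A (δ ≫ δ) η⁻¹ := by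
  intro η hη
  obtain ⟨ζ, hζ, rfl⟩ := exists_isPrimitiveRoot_sq_eq hk hk0 hη
  have hζi : IsPrimitiveRoot ζ⁻¹ (2 * k) := hζ.inv
  rw [← inv_pow, eigenMultiplicity_comp_self_sq_eq hk0 hδ hζ.pow_eq_one,
    eigenMultiplicity_comp_self_sq_eq hk0 hδ hζi.pow_eq_one, hsym ζ hζ,
    hsym (-ζ) (isPrimitiveRoot_neg_of_even hk hk0 hζ), inv_neg]

/-- **«`W_{F′}` consists of Hodge classes ⟹ `W_F` consists of Hodge classes» for `F = ℚ(δ²) ⊂ F′ = ℚ(δ)`**, through the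
analytic type: a symmetric type of `δ` (level `2k`, `k` even) makes every class of
`W_{ℚ(δ²)} ⊗ ℂ = weilClassesField A (δ ≫ δ) Φ_k s ⊂ Hˢ`, `φ(k)·s = 2g`, of Hodge type `(s/2, s/2)`.
[cite: MoonenZarhin1998WeilClasses, Remark (1) (chunk p0004 L44–L52) and §1 Criterion (chunk p0001 L93–L97)] -/
theorem forall_isOfHodgeType_weilClassesField_comp_self_of_symmetric (hk : 2 ∣ k) (hk0 : 0 < k)
    (hδ : (cyclotomic (2 * k) ℤ).eval₂ (Int.castRingHom (End A)) (End.of δ) = 0) {s : ℕ}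
    (hs : Nat.totient k * s = 2 * A.dim)
    (hsym : ∀ ζ : ℂ, IsPrimitiveRoot ζ (2 * k) → eigenMultiplicity A δ ζ = eigenMultiplicity A δ ζ⁻¹) :
    ∀ c ∈ weilClassesField A (δ ≫ δ) (cyclotomic k ℤ) s, IsOfHodgeType A.dim A.X s (s / 2) (s / 2) c :=
  fun _ hc ↦ isOfHodgeType_of_mem_weilClassesField_cyclotomic hk0 (eval₂_cyclotomic_comp_self_eq_zero hk hδ) hs
    (forall_eigenMultiplicity_comp_self_eq_inv_of_symmetric hk hk0 hδ hsym) hc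

/-- **Remark (1) on the carriers, Hodge form**: if ALL of `W_{ℚ(δ)} ⊗ ℂ = weilClassesField A δ Φ_{2k} r` (`φ(2k)·r = 2g`)
is of Hodge type `(r/2, r/2)`, then ALL of `W_{ℚ(δ²)} ⊗ ℂ = weilClassesField A (δ ≫ δ) Φ_k (2r)` is of Hodge type `(r, r)`
(`k` even). [cite: MoonenZarhin1998WeilClasses, Remark (1) (chunk p0004 L44–L52)] -/
theorem forall_isOfHodgeType_weilClassesField_comp_self_of_forall (hk : 2 ∣ k) (hk0 : 0 < k)
    (hδ : (cyclotomic (2 * k) ℤ).eval₂ (Int.castRingHom (End A)) (End.of δ) = 0) {r : ℕ}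
    (hr : Nat.totient (2 * k) * r = 2 * A.dim)
    (hH : ∀ c ∈ weilClassesField A δ (cyclotomic (2 * k) ℤ) r, IsOfHodgeType A.dim A.X r (r / 2) (r / 2) c) :
    ∀ c ∈ weilClassesField A (δ ≫ δ) (cyclotomic k ℤ) (2 * r), IsOfHodgeType A.dim A.X (2 * r) r r c := by
  have hsym := (forall_isOfHodgeType_weilClassesField_cyclotomic_iff (by omega) hδ hr).1 hH
  have hs : Nat.totient k * (2 * r) = 2 * A.dim := by rw [← hr, totient_two_mul_eq hk]; ring
  have h := forall_isOfHodgeType_weilClassesField_comp_self_of_symmetric hk hk0 hδ hs hsym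
  rw [Nat.mul_div_cancel_left r zero_lt_two] at h
  exact h

end Square

/-! ## §2 The Weil classes: `W_{ℚ(δ²)} ⊆ ⟨W_{ℚ(δ)} ⌣ W_{ℚ(δ)}⟩`, algebraicity descends -/

section WeilClasses

variable {A : Motives.AbelianVariety ℂ} {δ : A ⟶ A} {k r : ℕ}

/-- `δ ≫ δ = T²` evaluated at `δ` (the `hψ` datum of the tree's index-two theorems). [cite: MoonenZarhin1998WeilClasses, Remark (1) (chunk p0004)] -/
theorem comp_self_eq_eval₂_X_sq (δ : A ⟶ A) :
    ((δ ≫ δ : A ⟶ A) : End A) = Polynomial.eval₂ (Int.castRingHom (End A)) (δ : End A) (X ^ 2 : ℤ[X]) := by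
  rw [eval₂_X_pow, sq, End.mul_def]

/-- **«`W_F` is contained in the vector subspace generated by exterior products of elements of `W_{F′}`»** for
`F = ℚ(δ²) ⊂ F′ = ℚ(δ)`, `Φ_{2k}(δ) = 0`, `k > 1` even, `φ(2k)·r = 2g`:
`weilClassesField A (δ ≫ δ) Φ_k (r + r) ⊆ span_ℂ {a ⌣ b | a, b ∈ weilClassesField A δ Φ_{2k} r}`.
[cite: MoonenZarhin1998WeilClasses, Remark (1), last sentence (chunk p0004 L72–L76)] -/
theorem weilClassesField_comp_self_le_span_cupProduct (hk : 2 ∣ k) (hk1 : 1 < k)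
    (hδ : (cyclotomic (2 * k) ℤ).eval₂ (Int.castRingHom (End A)) (End.of δ) = 0)
    (hr : Nat.totient (2 * k) * r = 2 * A.dim) {n : ℕ} (h : r + r = n) :
    weilClassesField A (δ ≫ δ) (cyclotomic k ℤ) n ≤
      Submodule.span ℂ (Set.image2 (fun a b ↦ cupProduct h a b)
        (weilClassesField A δ (cyclotomic (2 * k) ℤ) r : Set (complexBetti A.X r))
        (weilClassesField A δ (cyclotomic (2 * k) ℤ) r)) :=
  weilClassesField_sq_le_span_cupProduct (cyclotomic_two_mul_eq_comp_X_sq hk) (eval₂_zero_cyclotomic_ne_zero hk1)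
    (cyclotomic.monic _ ℤ) (natDegree_cyclotomic _ ℤ)
    (by rw [map_cyclotomic]; exact cyclotomic.irreducible_rat (by omega)) hδ hr (comp_self_eq_eval₂_X_sq δ) h

/-- **Algebraicity descends from `W_{ℚ(δ)}` to `W_{ℚ(δ²)}`** (`Φ_{2k}(δ) = 0`, `k > 1` even, `φ(2k)·2m = 2g`): if
`W_{ℚ(δ)} ⊗ ℂ ⊂ H^{2m}` consists of algebraic classes, so does `W_{ℚ(δ²)} ⊗ ℂ ⊂ H^{4m}` (cup products of algebraic
classes are algebraic on an abelian variety, Voisin II Prop. 9.20 — the «decomposable» implication of Remark (1) with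
the algebraic subring in place of the divisor ring). [cite: MoonenZarhin1998WeilClasses, Remark (1) (chunk p0004 L64–L76)]
[cite: VoisinHodgeII2003, Prop. 9.20] -/
theorem weilClassesField_comp_self_le_algebraicClasses (hk : 2 ∣ k) (hk1 : 1 < k)
    (hδ : (cyclotomic (2 * k) ℤ).eval₂ (Int.castRingHom (End A)) (End.of δ) = 0) {m : ℕ}
    (hm : Nat.totient (2 * k) * (2 * m) = 2 * A.dim)
    (hW : weilClassesField A δ (cyclotomic (2 * k) ℤ) (2 * m) ≤ algebraicClasses A.X m) :
    weilClassesField A (δ ≫ δ) (cyclotomic k ℤ) (2 * (m + m)) ≤ algebraicClasses A.X (m + m) :=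
  weilClassesField_sq_le_algebraicClasses (cyclotomic_two_mul_eq_comp_X_sq hk) (eval₂_zero_cyclotomic_ne_zero hk1)
    (cyclotomic.monic _ ℤ) (natDegree_cyclotomic _ ℤ)
    (by rw [map_cyclotomic]; exact cyclotomic.irreducible_rat (by omega)) hδ hm (comp_self_eq_eval₂_X_sq δ) hW

/-- **ONE non-zero rational algebraic class of `W_{ℚ(δ)} ⊗ ℂ` makes all of `W_{ℚ(δ²)} ⊗ ℂ` algebraic** (`m > 0`; the
one-class lemma for `F′` and the descent). [cite: MoonenZarhin1998WeilClasses, §1 «dim_F W_F = 1» and Remark (1) (chunks p0001, p0004)]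
[cite: VoisinHodgeII2003, Prop. 9.20] -/
theorem weilClassesField_comp_self_le_algebraicClasses_of_isRationalClass (hk : 2 ∣ k) (hk1 : 1 < k)
    (hδ : (cyclotomic (2 * k) ℤ).eval₂ (Int.castRingHom (End A)) (End.of δ) = 0) {m : ℕ}
    (hm : Nat.totient (2 * k) * (2 * m) = 2 * A.dim) (hm0 : 0 < m) {γ : complexBetti A.X (2 * m)}
    (hγW : γ ∈ weilClassesField A δ (cyclotomic (2 * k) ℤ) (2 * m)) (hγQ : IsRationalClass γ) (hγ0 : γ ≠ 0)
    (hγalg : γ ∈ algebraicClasses A.X m) :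
    weilClassesField A (δ ≫ δ) (cyclotomic k ℤ) (2 * (m + m)) ≤ algebraicClasses A.X (m + m) :=
  weilClassesField_le_algebraicClasses_of_isRationalClass_of_eq_eval₂ (cyclotomic.monic _ ℤ) (natDegree_cyclotomic _ ℤ)
    (by rw [map_cyclotomic]; exact cyclotomic.irreducible_rat (by omega)) hδ hm hm0 (comp_self_eq_eval₂_X_sq δ)
    (two_roots_above_of_eq_comp_X_sq (cyclotomic_two_mul_eq_comp_X_sq hk) (eval₂_zero_cyclotomic_ne_zero hk1))
    hγW hγQ hγ0 hγalg

end WeilClasses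

/-! ## §3 Level `8` (`ℚ(δ²) = ℚ(i)`) and level `12` (`ℚ(δ²) = ℚ(ζ_6) = ℚ(√-3)`): Weil type of the square -/

section LevelEightTwelve

variable {A : Motives.AbelianVariety ℂ} {δ : A ⟶ A} {n : ℕ}

/-- `Φ_8(δ) = 0 ⟹ Φ_4(δ ≫ δ) = 0` (`ζ_8² = i`). [cite: vanGeemen1994HodgeAV, 4.9] -/
theorem eval₂_cyclotomic_four_comp_self_of_cyclotomic_eight
    (hδ : (cyclotomic 8 ℤ).eval₂ (Int.castRingHom (End A)) (End.of δ) = 0) :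
    (cyclotomic 4 ℤ).eval₂ (Int.castRingHom (End A)) (End.of (δ ≫ δ)) = 0 :=
  eval₂_cyclotomic_comp_self_eq_zero (k := 4) ⟨2, rfl⟩ (by rw [show 2 * 4 = 8 by norm_num]; exact hδ)

/-- `Φ_12(δ) = 0 ⟹ Φ_6(δ ≫ δ) = 0` (`ζ_12² = ζ_6`). [cite: vanGeemen1994HodgeAV, §7.2] -/
theorem eval₂_cyclotomic_six_comp_self_of_cyclotomic_twelve
    (hδ : (cyclotomic 12 ℤ).eval₂ (Int.castRingHom (End A)) (End.of δ) = 0) :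
    (cyclotomic 6 ℤ).eval₂ (Int.castRingHom (End A)) (End.of (δ ≫ δ)) = 0 :=
  eval₂_cyclotomic_comp_self_eq_zero (k := 6) ⟨3, rfl⟩ (by rw [show 2 * 6 = 12 by norm_num]; exact hδ)

/-- **Level `8`: `(A, δ²)` with `ℚ(δ²) = ℚ(i)` is of Weil type `(n, 1)` iff `0 < n ∧ dim A = 2n ∧ n_i(δ²) = n_{-i}(δ²)`**
(g36-#2 at level `4` for the square). [cite: vanGeemen1994HodgeAV, 4.9 (chunk p0218)] [cite: MoonenZarhin1998WeilClasses, Remark (1) (chunk p0004)] -/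
theorem isWeilType_comp_self_iff_of_cyclotomic_eight
    (hδ : (cyclotomic 8 ℤ).eval₂ (Int.castRingHom (End A)) (End.of δ) = 0) :
    IsWeilType A (δ ≫ δ) n 1 ↔
      0 < n ∧ A.dim = 2 * n ∧
        eigenMultiplicity A (δ ≫ δ) Complex.I = eigenMultiplicity A (δ ≫ δ) (-Complex.I) :=
  isWeilType_iff_of_cyclotomic_four (eval₂_cyclotomic_four_comp_self_of_cyclotomic_eight hδ)

/-- **A symmetric type at level `8` makes `(A, δ²)` of Weil type for `ℚ(i)`** (`dim A = 2n > 0`): «`W_{F′}` Hodge ⟹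
`W_F` Hodge» for `ℚ(i) ⊂ ℚ(ζ_8)`, in van Geemen's language. [cite: MoonenZarhin1998WeilClasses, Remark (1) (chunk p0004 L44–L52)]
[cite: vanGeemen1994HodgeAV, 4.9–4.10 (chunk p0218)] -/
theorem isWeilType_comp_self_of_symmetric_of_cyclotomic_eight
    (hδ : (cyclotomic 8 ℤ).eval₂ (Int.castRingHom (End A)) (End.of δ) = 0) (hn : 0 < n) (hdim : A.dim = 2 * n)
    (hsym : ∀ ζ : ℂ, IsPrimitiveRoot ζ 8 → eigenMultiplicity A δ ζ = eigenMultiplicity A δ ζ⁻¹) :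
    IsWeilType A (δ ≫ δ) n 1 := by
  have hδ' : (cyclotomic (2 * 4) ℤ).eval₂ (Int.castRingHom (End A)) (End.of δ) = 0 := by
    rw [show 2 * 4 = 8 by norm_num]; exact hδ
  have hsym' : ∀ ζ : ℂ, IsPrimitiveRoot ζ (2 * 4) → eigenMultiplicity A δ ζ = eigenMultiplicity A δ ζ⁻¹ := by
    rw [show 2 * 4 = 8 by norm_num]; exact hsym
  exact (isWeilType_iff_symmetric_of_cyclotomic_four (eval₂_cyclotomic_four_comp_self_of_cyclotomic_eight hδ) hn
    hdim).2 (forall_eigenMultiplicity_comp_self_eq_inv_of_symmetric (k := 4) ⟨2, rfl⟩ (by norm_num) hδ' hsym')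

/-- **A symmetric type at level `12` makes `(A, 2δ² - 1)` of Weil type `(n, 3)` for `ℚ(δ²) = ℚ(√-3)`** (`dim A = 2n > 0`;
`Φ_6(δ²) = 0`, g36-#2 at level `6`). [cite: MoonenZarhin1998WeilClasses, Remark (1) (chunk p0004 L44–L52)] [cite: vanGeemen1994HodgeAV, 4.9 and §7.2] -/
theorem isWeilType_of_symmetric_of_cyclotomic_twelve
    (hδ : (cyclotomic 12 ℤ).eval₂ (Int.castRingHom (End A)) (End.of δ) = 0) (hn : 0 < n) (hdim : A.dim = 2 * n)
    (hsym : ∀ ζ : ℂ, IsPrimitiveRoot ζ 12 → eigenMultiplicity A δ ζ = eigenMultiplicity A δ ζ⁻¹) :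
    IsWeilType A (2 • (δ ≫ δ) - 𝟙 A) n 3 := by
  have hδ' : (cyclotomic (2 * 6) ℤ).eval₂ (Int.castRingHom (End A)) (End.of δ) = 0 := by
    rw [show 2 * 6 = 12 by norm_num]; exact hδ
  have hsym' : ∀ ζ : ℂ, IsPrimitiveRoot ζ (2 * 6) → eigenMultiplicity A δ ζ = eigenMultiplicity A δ ζ⁻¹ := by
    rw [show 2 * 6 = 12 by norm_num]; exact hsym
  have hdesc := forall_eigenMultiplicity_comp_self_eq_inv_of_symmetric (k := 6) ⟨3, rfl⟩ (by norm_num) hδ' hsym'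
  have hξ := Complex.isPrimitiveRoot_exp 6 (by norm_num)
  set ξ := Complex.exp (2 * Real.pi * Complex.I / (6 : ℕ)) with hξdef
  have hξ' : IsPrimitiveRoot ξ (2 * 3) := by rw [show 2 * 3 = 6 by norm_num]; exact hξ
  -- `ω = ξ²` is a primitive cube root, `ξ³ = -1`, `-ω = ξ⁻¹`, `-ω⁻¹ = ξ`
  have hω : IsPrimitiveRoot (ξ ^ 2) 3 := isPrimitiveRoot_sq (by norm_num) hξ'
  have h3 : ξ ^ 3 = -1 := (hξ'.pow (by norm_num) (show 2 * 3 = 3 * 2 by norm_num)).eq_neg_one_of_two_right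
  have e1 : -(ξ ^ 2) = ξ⁻¹ :=
    (inv_eq_of_mul_eq_one_right
      (show ξ * -(ξ ^ 2) = 1 by rw [mul_neg, show ξ * ξ ^ 2 = ξ ^ 3 by ring, h3, neg_neg])).symm
  have e2 : -(ξ ^ 2)⁻¹ = ξ := by
    rw [inv_eq_of_mul_eq_one_right
      (show ξ ^ 2 * -ξ = 1 by rw [mul_neg, show ξ ^ 2 * ξ = ξ ^ 3 by ring, h3, neg_neg]), neg_neg]
  rw [isWeilType_two_smul_sub_id_iff_of_cyclotomic_six (eval₂_cyclotomic_six_comp_self_of_cyclotomic_twelve hδ) hω,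
    e1, e2]
  exact ⟨hn, hdim, (hdesc ξ hξ).symm⟩

end LevelEightTwelve

end AbelianVariety

end Literature.AlgebraicGeometry.HodgeTheory

end
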